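import Summits.AtomisticToContinuum.HydrodynamicLimit.Theorems.LambertianContactSwapContactAngleEquidistributionEqStaticFluxTools
import HarnessLib

/-!
# Integrating out the spectators of a midpoint-fibre integral (stub `stub_eqStaticFlux` of line
# `Sketch` v5, crux `LambertianContactSwap.ContactAngleEquidistribution`,
# stmt-AtomisticToContinuum-12097; lead `prover-line-stmt-AtomisticToContinuum-12097-c2-0`)

WHAT. Statics of the homogeneous canonical hard-sphere Gibbs state on `𝕋³`: for a measurable mark
`Ψ (x_mid, v_i, v_j, n)` reading only the contact midpoint, the two velocities and the contact
normal, the midpoint-fibre integral of `1_D ρ_N Ψ` (particle `i` at `x_j + (ε/2)ω`, particle `j` at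
`x_j − (ε/2)ω`, `ω ∈ S²`, velocities unchanged) equals
`∫ dx dv dw dω (ε²⟪ω, w − v⟫)₊ M(v) M(w) Ψ(x,v,w,ω) v_{N+1}(x + (ε/2)ω, x − (ε/2)ω)`, with
`v_n = u_ε(·)(n−2)/Ξ_ε(n)` the normalised pinned hard-core probability (`vcan`).

HOW. Tonelli puts `ω` outermost on both sides (`lintegral4_swap`). For fixed `ω`
(`lintegral_fibre_static`): on the fibre the pair separation is exactly `εω`, so the midpoint is `x_j`,
the normal is `ω` and the Gibbs weight is `Ξ_ε(N+1)⁻¹ ∏_k M(v_k)`, while the hard-core constraint is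
the pinned hard-core event of the spectator positions about the dumbbell (`stub_eqStaticFluxPointwise`);
positions and velocities are separated (`zipConfig`), only the velocities `i, j` are read
(`lintegral_vel_pair`), the dummy position `x_i` gives `1` and the spectator positions give the pinned
probability `u_ε(dumbbell)(N − 1)` (`lintegral_ite_pinnedHC`) — `lintegral_lhs_form`; finally
`vcan = u_ε/Ξ_ε` (`lintegral_rhs_form`). Tools in `…EqStaticFluxTools.lean`.

References: E. Pulvirenti, D. Tsagkarogiannis, Comm. Math. Phys. 316 (2012), §3, §5 (canonical
correlation functions as ratios of pinned partition functions); C. Cercignani, R. Illner,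
M. Pulvirenti, *The Mathematical Theory of Dilute Gases* (1994), App. 4.A.
-/

noncomputable section

open MeasureTheory Filter Set Topology ProbabilityTheory Function
open scoped ENNReal BigOperators Classical RealInnerProductSpace

namespace Summit.AtomisticToContinuum.HydrodynamicLimit.Theorems.ContactAngleEquidistributionSketch

open Literature.Analysis.FluidPDE Literature.MathematicalPhysics.KineticTheory

namespace EqStaticFlux

/-- **The left-hand side after the pointwise reduction**: positions and velocities are separated
(`zipConfig`), the velocity integral is `lintegral_vel_pair`, the position integral is
`lintegral_ite_pinnedHC`. [cite: PulvirentiTsagkarogiannis2012, §5] -/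
theorem lintegral_lhs_form {ε θ : ℝ} (hθ : 0 < θ) {N m : ℕ} {i j : Fin (N + 1)} (hij : i ≠ j)
    {rest : Finset (Fin (N + 1))} (hir : i ∉ rest) (hjr : j ∉ rest)
    (huniv : (Finset.univ : Finset (Fin (N + 1))) = insert j (insert i rest)) (e : ↥rest ≃ Fin m)
    {H : T3 × (V3 × V3) → ℝ≥0∞} (hH : Measurable H) {Y : T3 → Fin 2 → T3} (hY : Measurable Y)
    {C : ℝ≥0∞} (hC : C ≠ ⊤) :
    ∫⁻ z : Config (N + 1) (Fin 3) T3, (∏ k, ENNReal.ofReal (localMaxwellian 1 θ 0 (z k).2)) *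
        H ((z j).1, ((z i).2, (z j).2)) *
          (C * if PinnedHC ε (Y (z j).1) (fun l => (z (e.symm l)).1) then 1 else 0) =
      C * ∫⁻ c, (∫⁻ a, ENNReal.ofReal (localMaxwellian 1 θ 0 a) *
        ∫⁻ b, ENNReal.ofReal (localMaxwellian 1 θ 0 b) * H (c, (a, b))) *
          ENNReal.ofReal (pinnedXi ε (Y c) m) := by
  have hMm : Measurable fun v : V3 => ENNReal.ofReal (localMaxwellian 1 θ 0 v) :=
    (continuous_localMaxwellian 1 θ 0).measurable.ennreal_ofReal
  have hprodm : Measurable fun v : Fin (N + 1) → V3 => ∏ k, ENNReal.ofReal (localMaxwellian 1 θ 0 (v k)) :=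
    Finset.measurable_prod _ fun k _ => hMm.comp (measurable_pi_apply k)
  have hI : Measurable fun z : Config (N + 1) (Fin 3) T3 =>
      (∏ k, ENNReal.ofReal (localMaxwellian 1 θ 0 (z k).2)) * H ((z j).1, ((z i).2, (z j).2)) *
        (C * if PinnedHC ε (Y (z j).1) (fun l => (z (e.symm l)).1) then 1 else 0) := by
    refine ((Finset.measurable_prod _ fun k _ => hMm.comp (measurable_pi_apply k).snd).mul
      (hH.comp ((measurable_pi_apply j).fst.prodMk ((measurable_pi_apply i).snd.prodMk
        (measurable_pi_apply j).snd)))).mul (measurable_const.mul (Measurable.ite ?_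
          measurable_const measurable_const))
    exact measurableSet_setOf_pinnedHC ε (hY.comp (measurable_pi_apply j).fst)
      (measurable_pi_lambda _ fun l => (measurable_pi_apply _).fst)
  have hΦ : ∀ c, ∫⁻ v : Fin (N + 1) → V3,
      (∏ k, ENNReal.ofReal (localMaxwellian 1 θ 0 (v k))) * H (c, (v i, v j)) =
      ∫⁻ a, ENNReal.ofReal (localMaxwellian 1 θ 0 a) *
        ∫⁻ b, ENNReal.ofReal (localMaxwellian 1 θ 0 b) * H (c, (a, b)) :=
    fun c => lintegral_vel_pair hθ hij (hH.comp (measurable_const.prodMk measurable_id))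
  have hΦm : Measurable fun c => ∫⁻ a, ENNReal.ofReal (localMaxwellian 1 θ 0 a) *
      ∫⁻ b, ENNReal.ofReal (localMaxwellian 1 θ 0 b) * H (c, (a, b)) := by
    have h1 : Measurable fun q : (T3 × V3) × V3 =>
        ENNReal.ofReal (localMaxwellian 1 θ 0 q.2) * H (q.1.1, (q.1.2, q.2)) :=
      (hMm.comp measurable_snd).mul (hH.comp (measurable_fst.fst.prodMk
        (measurable_fst.snd.prodMk measurable_snd)))
    have h2 : Measurable fun q : T3 × V3 => ENNReal.ofReal (localMaxwellian 1 θ 0 q.2) *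
        ∫⁻ b, ENNReal.ofReal (localMaxwellian 1 θ 0 b) * H (q.1, (q.2, b)) :=
      (hMm.comp measurable_snd).mul h1.lintegral_prod_right'
    exact h2.lintegral_prod_right'
  set F : Config (N + 1) (Fin 3) T3 → ℝ≥0∞ := fun z =>
    (∏ k, ENNReal.ofReal (localMaxwellian 1 θ 0 (z k).2)) * H ((z j).1, ((z i).2, (z j).2)) *
      (C * if PinnedHC ε (Y (z j).1) (fun l => (z (e.symm l)).1) then 1 else 0) with hF
  have hIz : AEMeasurable (fun p : (Fin (N + 1) → T3) × (Fin (N + 1) → V3) => F (zipConfig p))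
      ((volume : Measure (Fin (N + 1) → T3)).prod (volume : Measure (Fin (N + 1) → V3))) :=
    (hI.comp measurable_zipConfig).aemeasurable
  rw [← measurePreserving_zipConfig.lintegral_comp_emb
    (MeasurableEquiv.arrowProdEquivProdArrow T3 V3 (Fin (N + 1))).symm.measurableEmbedding,
    lintegral_prod _ hIz]
  simp only [hF, zipConfig_apply]
  calc ∫⁻ x : Fin (N + 1) → T3, ∫⁻ v : Fin (N + 1) → V3,
        (∏ k, ENNReal.ofReal (localMaxwellian 1 θ 0 (v k))) * H (x j, (v i, v j)) *
          (C * if PinnedHC ε (Y (x j)) (fun l => x (e.symm l)) then 1 else 0)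
      = ∫⁻ x : Fin (N + 1) → T3, (∫⁻ a, ENNReal.ofReal (localMaxwellian 1 θ 0 a) *
          ∫⁻ b, ENNReal.ofReal (localMaxwellian 1 θ 0 b) * H (x j, (a, b))) *
          (C * if PinnedHC ε (Y (x j)) (fun l => x (e.symm l)) then 1 else 0) := by
        refine lintegral_congr fun x => ?_
        have hx : Measurable fun v : Fin (N + 1) → V3 =>
            (∏ k, ENNReal.ofReal (localMaxwellian 1 θ 0 (v k))) * H (x j, (v i, v j)) :=
          hprodm.mul (hH.comp (measurable_const.prodMk
            ((measurable_pi_apply i).prodMk (measurable_pi_apply j))))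
        rw [lintegral_mul_const _ hx, hΦ]
    _ = C * ∫⁻ x : Fin (N + 1) → T3, (if PinnedHC ε (Y (x j)) (fun l => x (e.symm l)) then
          ∫⁻ a, ENNReal.ofReal (localMaxwellian 1 θ 0 a) *
            ∫⁻ b, ENNReal.ofReal (localMaxwellian 1 θ 0 b) * H (x j, (a, b)) else 0) := by
        rw [← lintegral_const_mul' _ _ hC]
        refine lintegral_congr fun x => ?_
        split_ifs <;> ring
    _ = _ := by rw [lintegral_ite_pinnedHC ε hij hir hjr huniv e hY hΦm]

end EqStaticFlux

open EqStaticFlux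

/-! ### The fibre identity for a fixed unit normal -/

/-- **The midpoint-fibre integral of `1_D ρ_N Ψ` for a FIXED unit normal `ω`** equals
`∫ dx ∫ dv ∫ dw (ε²⟪ω, w − v⟫)₊ M(v) M(w) Ψ(x, v, w, ω) v_{N+1}(x + (ε/2)ω, x − (ε/2)ω)`
(`0 < ε < 1/2`, `θ > 0`, `i ≠ j`): the pointwise reduction `stub_eqStaticFluxPointwise`, the separation of
positions and velocities `lintegral_lhs_form`, and `vcan = u_ε/Ξ_ε`. [cite: PulvirentiTsagkarogiannis2012, §5] -/
theorem lintegral_fibre_static {ε : ℝ} (hε0 : 0 < ε) (hεh : ε < 1 / 2) {θ : ℝ} (hθ : 0 < θ) {N : ℕ}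
    {i j : Fin (N + 1)} (hij : i ≠ j) (Ψ : T3 → V3 → V3 → V3 → ℝ≥0∞)
    (hΨ : Measurable fun p : T3 × V3 × V3 × V3 => Ψ p.1 p.2.1 p.2.2.1 p.2.2.2)
    (ω : V3) (hω : ‖ω‖ = 1) :
    ∫⁻ z : Config (N + 1) (Fin 3) T3,
        ENNReal.ofReal (ε ^ (Fintype.card (Fin 3) - 1) * ⟪ω, (z j).2 - (z i).2⟫) *
          (hardSphereDomain (Torus.geometry (Fin 3)) (N + 1) ε).indicator
            (fun y => ENNReal.ofReal (canonicalDensity (Torus.geometry (Fin 3)) ε (N + 1)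
                (localGibbsProfile (fun _ => 1) (fun _ => 0) (fun _ => θ)) y) *
              Ψ ((Torus.geometry (Fin 3)).translate (y j).1
                  ((2 : ℝ)⁻¹ • (Torus.geometry (Fin 3)).sepVec (y i).1 (y j).1))
                (y i).2 (y j).2 (ε⁻¹ • (Torus.geometry (Fin 3)).sepVec (y i).1 (y j).1))
            (update (update z i
                ((z j).1 + Literature.Analysis.FunctionSpaces.Torus.proj ((ε / 2) • ω), (z i).2)) j
              ((z j).1 + Literature.Analysis.FunctionSpaces.Torus.proj (-((ε / 2) • ω)), (z j).2)) =
      ∫⁻ x : T3, ∫⁻ v : V3, ∫⁻ w : V3,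
        ENNReal.ofReal (ε ^ (Fintype.card (Fin 3) - 1) * ⟪ω, w - v⟫) *
          ENNReal.ofReal (localMaxwellian 1 θ 0 v * localMaxwellian 1 θ 0 w) * Ψ x v w ω *
            ENNReal.ofReal (vcan ε (N + 1)
              ![x + Literature.Analysis.FunctionSpaces.Torus.proj ((ε / 2) • ω),
                x + Literature.Analysis.FunctionSpaces.Torus.proj (-((ε / 2) • ω))]) := by
  -- the spectator labels
  set rest := ((Finset.univ : Finset (Fin (N + 1))).erase j).erase i with hrest
  have hcard : rest.card = N + 1 - 2 := by
    rw [hrest, Finset.card_erase_of_mem (Finset.mem_erase.2 ⟨hij, Finset.mem_univ i⟩),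
      Finset.card_erase_of_mem (Finset.mem_univ j), Finset.card_univ, Fintype.card_fin]
    omega
  have hir : i ∉ rest := Finset.notMem_erase i _
  have hjr : j ∉ rest := fun h => (Finset.mem_erase.1 (Finset.mem_of_mem_erase h)).1 rfl
  have huniv : (Finset.univ : Finset (Fin (N + 1))) = insert j (insert i rest) := by
    rw [hrest, Finset.insert_erase (Finset.mem_erase.2 ⟨hij, Finset.mem_univ i⟩),
      Finset.insert_erase (Finset.mem_univ j)]
  set e : ↥rest ≃ Fin (N + 1 - 2) := Finset.equivFinOfCardEq hcard with he_def
  have hei : ∀ l, ((e.symm l : ↥rest) : Fin (N + 1)) ≠ i := fun l h =>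
    (Finset.mem_erase.1 (e.symm l).2).1 h
  have hej : ∀ l, ((e.symm l : ↥rest) : Fin (N + 1)) ≠ j := fun l h =>
    (Finset.mem_erase.1 (Finset.mem_erase.1 (e.symm l).2).2).1 h
  have hinj : Injective fun l => ((e.symm l : ↥rest) : Fin (N + 1)) :=
    Subtype.val_injective.comp e.symm.injective
  have hcov : ∀ k, k ≠ i → k ≠ j → ∃ l, ((e.symm l : ↥rest) : Fin (N + 1)) = k :=
    fun k hki hkj => ⟨e ⟨k, Finset.mem_erase.2 ⟨hki, Finset.mem_erase.2 ⟨hkj, Finset.mem_univ k⟩⟩⟩,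
      by simp⟩
  -- measurability of the reduced mark and of the dumbbell
  have hH : Measurable fun q : T3 × (V3 × V3) =>
      ENNReal.ofReal (ε ^ (Fintype.card (Fin 3) - 1) * ⟪ω, q.2.2 - q.2.1⟫) * Ψ q.1 q.2.1 q.2.2 ω :=
    (measurable_const.mul (measurable_const.inner (measurable_snd.snd.sub
      measurable_snd.fst))).ennreal_ofReal.mul (hΨ.comp (measurable_fst.prodMk
        (measurable_snd.fst.prodMk (measurable_snd.snd.prodMk measurable_const))))
  have hY : Measurable fun c : T3 =>
      ![c + Literature.Analysis.FunctionSpaces.Torus.proj ((ε / 2) • ω),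
        c + Literature.Analysis.FunctionSpaces.Torus.proj (-((ε / 2) • ω))] := by
    refine measurable_pi_lambda _ fun a => ?_
    fin_cases a
    · simpa using measurable_id.add_const _
    · simpa using measurable_id.add_const _
  calc _ = ∫⁻ z : Config (N + 1) (Fin 3) T3, (∏ k, ENNReal.ofReal (localMaxwellian 1 θ 0 (z k).2)) *
          (ENNReal.ofReal (ε ^ (Fintype.card (Fin 3) - 1) * ⟪ω, (z j).2 - (z i).2⟫) *
            Ψ (z j).1 (z i).2 (z j).2 ω) *
          (ENNReal.ofReal (XiT ε (N + 1))⁻¹ *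
            if PinnedHC ε ![(z j).1 + Literature.Analysis.FunctionSpaces.Torus.proj ((ε / 2) • ω),
                (z j).1 + Literature.Analysis.FunctionSpaces.Torus.proj (-((ε / 2) • ω))]
              (fun l => (z ((e.symm l : ↥rest) : Fin (N + 1))).1) then 1 else 0) :=
        lintegral_congr fun z => stub_eqStaticFluxPointwise hε0 hεh hθ hij Ψ hω hinj hei hej hcov z
    _ = ENNReal.ofReal (XiT ε (N + 1))⁻¹ * ∫⁻ c, (∫⁻ a, ENNReal.ofReal (localMaxwellian 1 θ 0 a) *
          ∫⁻ b, ENNReal.ofReal (localMaxwellian 1 θ 0 b) *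
            (ENNReal.ofReal (ε ^ (Fintype.card (Fin 3) - 1) * ⟪ω, b - a⟫) * Ψ c a b ω)) *
          ENNReal.ofReal (pinnedXi ε
            ![c + Literature.Analysis.FunctionSpaces.Torus.proj ((ε / 2) • ω),
              c + Literature.Analysis.FunctionSpaces.Torus.proj (-((ε / 2) • ω))] (N + 1 - 2)) :=
        lintegral_lhs_form hθ hij hir hjr huniv e hH hY ENNReal.ofReal_ne_top
    _ = ∫⁻ c, ENNReal.ofReal (XiT ε (N + 1))⁻¹ * ((∫⁻ a, ENNReal.ofReal (localMaxwellian 1 θ 0 a) *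
          ∫⁻ b, ENNReal.ofReal (localMaxwellian 1 θ 0 b) *
            (ENNReal.ofReal (ε ^ (Fintype.card (Fin 3) - 1) * ⟪ω, b - a⟫) * Ψ c a b ω)) *
          ENNReal.ofReal (pinnedXi ε
            ![c + Literature.Analysis.FunctionSpaces.Torus.proj ((ε / 2) • ω),
              c + Literature.Analysis.FunctionSpaces.Torus.proj (-((ε / 2) • ω))] (N + 1 - 2))) := by
        rw [lintegral_const_mul' _ _ ENNReal.ofReal_ne_top]
    _ = _ := lintegral_congr fun c => (lintegral_rhs_form
        (fun v => localMaxwellian_nonneg zero_le_one hθ.le (0 : V3) v)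
        (fun v w => ENNReal.ofReal (ε ^ (Fintype.card (Fin 3) - 1) * ⟪ω, w - v⟫)) (fun v w => Ψ c v w ω)
        (pinnedXi_nonneg ε _ (N + 1 - 2)) (XiT ε (N + 1))).symm

/-! ### The stub -/

/-- **Registered sub-goal `stub_eqStaticFlux`** (line `Sketch` v5, crux ContactAngleEquidistribution,
stmt-AtomisticToContinuum-12097): INTEGRATING OUT THE SPECTATORS. For `0 < σ < 1/2`, `θ > 0`, `i ≠ j`
and a measurable mark `Ψ (x_mid, v_i, v_j, n)`, the midpoint-fibre integral of `1_D ρ_N Ψ` equals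
`∫ dx ∫ dv ∫ dw ∫_{S²} dω (ε²⟪ω, w − v⟫)₊ M_θ(v) M_θ(w) Ψ(x, v, w, ω) · vcan ε (N+1) (x + (ε/2)ω, x − (ε/2)ω)`
(Tonelli in `ω` on both sides and `lintegral_fibre_static`). [cite: PulvirentiTsagkarogiannis2012, §3, §5] -/
theorem stub_eqStaticFlux {σ : ℝ} (hσ : 0 < σ) (hσh : σ < 1 / 2) {θ : ℝ} (hθ : 0 < θ) {N : ℕ}
    {i j : Fin (N + 1)} (hij : i ≠ j) (Ψ : T3 → V3 → V3 → V3 → ℝ≥0∞)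
    (hΨ : Measurable fun p : T3 × V3 × V3 × V3 => Ψ p.1 p.2.1 p.2.2.1 p.2.2.2) :
    ∫⁻ z : Config (N + 1) (Fin 3) T3, ∫⁻ ω : Metric.sphere (0 : V3) 1,
        ENNReal.ofReal (hsDiameter σ N ^ (Fintype.card (Fin 3) - 1) * ⟪((ω : V3)), (z j).2 - (z i).2⟫) *
          (hardSphereDomain (Torus.geometry (Fin 3)) (N + 1) (hsDiameter σ N)).indicator
            (fun y => ENNReal.ofReal (canonicalDensity (Torus.geometry (Fin 3)) (hsDiameter σ N) (N + 1)
                (localGibbsProfile (fun _ => 1) (fun _ => 0) (fun _ => θ)) y) *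
              Ψ ((Torus.geometry (Fin 3)).translate (y j).1
                  ((2 : ℝ)⁻¹ • (Torus.geometry (Fin 3)).sepVec (y i).1 (y j).1))
                (y i).2 (y j).2 ((hsDiameter σ N)⁻¹ • (Torus.geometry (Fin 3)).sepVec (y i).1 (y j).1))
            (Function.update (Function.update z i
                ((z j).1 + Literature.Analysis.FunctionSpaces.Torus.proj ((hsDiameter σ N / 2) • (ω : V3)),
                  (z i).2)) j
              ((z j).1 + Literature.Analysis.FunctionSpaces.Torus.proj (-((hsDiameter σ N / 2) • (ω : V3))),
                (z j).2))
        ∂(volume : Measure V3).toSphere =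
      ∫⁻ x : T3, ∫⁻ v : V3, ∫⁻ w : V3, ∫⁻ ω : Metric.sphere (0 : V3) 1,
        ENNReal.ofReal (hsDiameter σ N ^ (Fintype.card (Fin 3) - 1) * ⟪((ω : V3)), w - v⟫) *
          ENNReal.ofReal (localMaxwellian 1 θ 0 v * localMaxwellian 1 θ 0 w) * Ψ x v w ω *
            ENNReal.ofReal (vcan (hsDiameter σ N) (N + 1)
              ![x + Literature.Analysis.FunctionSpaces.Torus.proj ((hsDiameter σ N / 2) • (ω : V3)),
                x + Literature.Analysis.FunctionSpaces.Torus.proj (-((hsDiameter σ N / 2) • (ω : V3)))])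
        ∂(volume : Measure V3).toSphere := by
  haveI : SigmaFinite (volume : Measure (T3 × V3)) := inferInstance
  haveI : SigmaFinite (volume : Measure (Config (N + 1) (Fin 3) T3)) := inferInstance
  have hεh : hsDiameter σ N < 1 / 2 := (hsDiameter_le hσ.le N).trans_lt hσh
  -- measurability on the left, jointly in `p = (z, ω)` (as in `stub_fluxMidpoint`)
  have hDm : MeasurableSet (hardSphereDomain (Torus.geometry (Fin 3)) (N + 1) (hsDiameter σ N)) :=
    measurableSet_hardSphereDomain _ Torus.measurable_geometry_sepVec (N + 1) (hsDiameter σ N)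
  have hωm : Measurable fun p : Config (N + 1) (Fin 3) T3 × Metric.sphere (0 : V3) 1 => (p.2 : V3) :=
    measurable_subtype_coe.comp measurable_snd
  have hzk : ∀ k : Fin (N + 1), Measurable fun p : Config (N + 1) (Fin 3) T3 ×
      Metric.sphere (0 : V3) 1 => p.1 k := fun k => (measurable_pi_apply k).comp measurable_fst
  have hproj := Literature.Analysis.FunctionSpaces.Torus.measurable_proj (d := Fin 3)
  have hs1 : Measurable fun p : Config (N + 1) (Fin 3) T3 × Metric.sphere (0 : V3) 1 =>
      (hsDiameter σ N / 2) • (p.2 : V3) := hωm.const_smul (hsDiameter σ N / 2)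
  have hmid : Measurable fun p : Config (N + 1) (Fin 3) T3 × Metric.sphere (0 : V3) 1 =>
      Function.update (Function.update p.1 i
        ((p.1 j).1 + Literature.Analysis.FunctionSpaces.Torus.proj ((hsDiameter σ N / 2) • (p.2 : V3)),
          (p.1 i).2)) j
        ((p.1 j).1 + Literature.Analysis.FunctionSpaces.Torus.proj (-((hsDiameter σ N / 2) • (p.2 : V3))),
          (p.1 j).2) :=
    measurable_update'.comp ((measurable_update'.comp (measurable_fst.prodMk
      (((hzk j).fst.add (hproj.comp hs1)).prodMk (hzk i).snd))).prodMk
      (((hzk j).fst.add (hproj.comp hs1.neg)).prodMk (hzk j).snd))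
  have hid : Measurable (id : Config (N + 1) (Fin 3) T3 → Config (N + 1) (Fin 3) T3) := measurable_id
  have hsep := NearField.measurable_sepVec' hid i j
  have hxm := NearField.measurable_xmid' hid i j
  have hvi := NearField.measurable_vel' hid i
  have hvj := NearField.measurable_vel' hid j
  have hnn : Measurable fun y : Config (N + 1) (Fin 3) T3 =>
      (hsDiameter σ N)⁻¹ • (Torus.geometry (Fin 3)).sepVec (y i).1 (y j).1 :=
    hsep.const_smul ((hsDiameter σ N)⁻¹)
  have hΨy : Measurable fun y : Config (N + 1) (Fin 3) T3 =>
      Ψ ((Torus.geometry (Fin 3)).translate (y j).1 ((2 : ℝ)⁻¹ • (Torus.geometry (Fin 3)).sepVec (y i).1 (y j).1))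
        (y i).2 (y j).2 ((hsDiameter σ N)⁻¹ • (Torus.geometry (Fin 3)).sepVec (y i).1 (y j).1) :=
    hΨ.comp (hxm.prodMk (hvi.prodMk (hvj.prodMk hnn)))
  have hρm : Measurable fun y : Config (N + 1) (Fin 3) T3 =>
      ENNReal.ofReal (canonicalDensity (Torus.geometry (Fin 3)) (hsDiameter σ N) (N + 1)
        (localGibbsProfile (fun _ => 1) (fun _ => 0) (fun _ => θ)) y) :=
    (measurable_canonicalDensity (hsDiameter σ N) (N + 1) (measurable_localGibbsProfile continuous_const
      continuous_const continuous_const)).ennreal_ofReal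
  have hH : Measurable fun y : Config (N + 1) (Fin 3) T3 =>
      ENNReal.ofReal (canonicalDensity (Torus.geometry (Fin 3)) (hsDiameter σ N) (N + 1)
        (localGibbsProfile (fun _ => 1) (fun _ => 0) (fun _ => θ)) y) *
      Ψ ((Torus.geometry (Fin 3)).translate (y j).1 ((2 : ℝ)⁻¹ • (Torus.geometry (Fin 3)).sepVec (y i).1 (y j).1))
        (y i).2 (y j).2 ((hsDiameter σ N)⁻¹ • (Torus.geometry (Fin 3)).sepVec (y i).1 (y j).1) :=
    hρm.mul hΨy
  have hker : Measurable fun p : Config (N + 1) (Fin 3) T3 × Metric.sphere (0 : V3) 1 =>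
      ENNReal.ofReal (hsDiameter σ N ^ (Fintype.card (Fin 3) - 1) * ⟪((p.2 : V3)), (p.1 j).2 - (p.1 i).2⟫) :=
    (measurable_const.mul (hωm.inner ((hzk j).snd.sub (hzk i).snd))).ennreal_ofReal
  have hA : AEMeasurable (uncurry fun (z : Config (N + 1) (Fin 3) T3) (ω : Metric.sphere (0 : V3) 1) =>
      ENNReal.ofReal (hsDiameter σ N ^ (Fintype.card (Fin 3) - 1) * ⟪((ω : V3)), (z j).2 - (z i).2⟫) *
        (hardSphereDomain (Torus.geometry (Fin 3)) (N + 1) (hsDiameter σ N)).indicator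
          (fun y => ENNReal.ofReal (canonicalDensity (Torus.geometry (Fin 3)) (hsDiameter σ N) (N + 1)
              (localGibbsProfile (fun _ => 1) (fun _ => 0) (fun _ => θ)) y) *
            Ψ ((Torus.geometry (Fin 3)).translate (y j).1
                ((2 : ℝ)⁻¹ • (Torus.geometry (Fin 3)).sepVec (y i).1 (y j).1))
              (y i).2 (y j).2 ((hsDiameter σ N)⁻¹ • (Torus.geometry (Fin 3)).sepVec (y i).1 (y j).1))
          (Function.update (Function.update z i
              ((z j).1 + Literature.Analysis.FunctionSpaces.Torus.proj ((hsDiameter σ N / 2) • (ω : V3)),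
                (z i).2)) j
            ((z j).1 + Literature.Analysis.FunctionSpaces.Torus.proj (-((hsDiameter σ N / 2) • (ω : V3))),
              (z j).2)))
      ((volume : Measure (Config (N + 1) (Fin 3) T3)).prod (volume : Measure V3).toSphere) :=
    (hker.mul ((hH.indicator hDm).comp hmid)).aemeasurable
  -- measurability on the right, jointly in `(x, v, w, ω)`
  have hg : Measurable fun p : T3 × V3 × V3 × Metric.sphere (0 : V3) 1 =>
      (fun (x : T3) (v w : V3) (ω : Metric.sphere (0 : V3) 1) =>
        ENNReal.ofReal (hsDiameter σ N ^ (Fintype.card (Fin 3) - 1) * ⟪((ω : V3)), w - v⟫) *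
          ENNReal.ofReal (localMaxwellian 1 θ 0 v * localMaxwellian 1 θ 0 w) * Ψ x v w ω *
            ENNReal.ofReal (vcan (hsDiameter σ N) (N + 1)
              ![x + Literature.Analysis.FunctionSpaces.Torus.proj ((hsDiameter σ N / 2) • (ω : V3)),
                x + Literature.Analysis.FunctionSpaces.Torus.proj (-((hsDiameter σ N / 2) • (ω : V3)))]))
        p.1 p.2.1 p.2.2.1 p.2.2.2 := by
    beta_reduce
    have hω' : Measurable fun p : T3 × V3 × V3 × Metric.sphere (0 : V3) 1 => (p.2.2.2 : V3) :=
      measurable_subtype_coe.comp measurable_snd.snd.snd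
    have hMc := (continuous_localMaxwellian (E := V3) 1 θ 0).measurable
    have hu : Measurable fun p : T3 × V3 × V3 × Metric.sphere (0 : V3) 1 =>
        (hsDiameter σ N / 2) • (p.2.2.2 : V3) := hω'.const_smul (hsDiameter σ N / 2)
    have hY0 : Measurable fun p : T3 × V3 × V3 × Metric.sphere (0 : V3) 1 =>
        p.1 + Literature.Analysis.FunctionSpaces.Torus.proj ((hsDiameter σ N / 2) • (p.2.2.2 : V3)) :=
      measurable_fst.add (hproj.comp hu)
    have hY1 : Measurable fun p : T3 × V3 × V3 × Metric.sphere (0 : V3) 1 =>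
        p.1 + Literature.Analysis.FunctionSpaces.Torus.proj (-((hsDiameter σ N / 2) • (p.2.2.2 : V3))) :=
      measurable_fst.add (hproj.comp hu.neg)
    have hYm : Measurable fun p : T3 × V3 × V3 × Metric.sphere (0 : V3) 1 =>
        ![p.1 + Literature.Analysis.FunctionSpaces.Torus.proj ((hsDiameter σ N / 2) • (p.2.2.2 : V3)),
          p.1 + Literature.Analysis.FunctionSpaces.Torus.proj (-((hsDiameter σ N / 2) • (p.2.2.2 : V3)))] := by
      refine measurable_pi_lambda _ fun a => ?_
      fin_cases a
      · simpa using hY0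
      · simpa using hY1
    refine (((measurable_const.mul (hω'.inner (measurable_snd.snd.fst.sub
      measurable_snd.fst))).ennreal_ofReal.mul ((hMc.comp measurable_snd.fst).mul
        (hMc.comp measurable_snd.snd.fst)).ennreal_ofReal).mul (hΨ.comp (measurable_fst.prodMk
          (measurable_snd.fst.prodMk (measurable_snd.snd.fst.prodMk hω'))))).mul ?_
    simp only [vcan]
    exact ((measurable_pinnedXi_comp _ hYm _).div_const _).ennreal_ofReal
  rw [lintegral_lintegral_swap hA, lintegral4_swap hg]
  refine lintegral_congr fun ω => ?_
  exact lintegral_fibre_static (hsDiameter_pos hσ N) hεh hθ hij Ψ hΨ (ω : V3) (norm_eq_of_mem_sphere ω)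

end Summit.AtomisticToContinuum.HydrodynamicLimit.Theorems.ContactAngleEquidistributionSketch

end
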